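import Mathlib.Data.Nat.Choose.Cast
import Literature.InformationTheory.QuantumCodes.LinearProgrammingBoundAdditive
import HarnessLib

/-!
# Analytic linear-programming bounds for distance-three stabilizer codes (Yu–Bierbrauer–Dong–Chen–Oh 2013, Thm. 3)

Topic `Literature/InformationTheory/QuantumCodes` (venture QEC, cell `qec`; LIT-1 custody, rung X1 «LP upper bounds per
`(n,k)`», the `d = 3` column beyond the `n ≤ 30` tables). S. Yu, J. Bierbrauer, Y. Dong, Q. Chen, C. H. Oh, *All the
stabilizer codes of distance 3*, IEEE Trans. Inform. Theory 59 (2013) 5179–5185 = arXiv:0901.1968 [YuEtAl2013], §IV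
«The linear programming bound» (lit chunk p0007, read on the page 2026-08-27):

«Linear Programming bound (Restricted set) If there exists a stabilizer code `[[n,k,3]]` then the following conditions
hold true: `A_1 = ⟨3n − 4x⟩`, `A_2 = ½⟨(4x − 3n + 1)² − 3n − 1⟩`, `Σ_{i=0}^{⌊n/2⌋} A_{2i} ≥ 2^{s−1}` [with
`⟨f(x)⟩ ≡ 2^{−s} Σ_i f(i) A_i`, `s = n − k`] … **Theorem 3.** If there exists a stabilizer code `[[n,k,3]]`, degenerate or
non-degenerate, for a length `n` equals `f_{m+2} − 1` or `8f_m + 1` or `8f_m + 2` with `f_m = (4^m − 1)/3` and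
`m = 1, 2, …,` then `n − k ≥ s_H + 1`, while the quantum Hamming bound for the 1-error-correcting stabilizer codes of
length `n` reads `n − k ≥ s_H = ⌈log₂(3n+1)⌉`.» (Proof, ibid.: the nonnegative quadratics
`h(x) = 16(x − 3n/4)(x − 1 − 3n/4)`, `f(x) = 16(x − (3n+1)/4)²`, `g(x) = 16(x − (3n+2)/4)(x − (3n−2)/4)` averaged against
the weight distribution.)

The three printed LP conditions are consequences of CRSS's system (16)–(21) [CalderbankEtAl1998, §7 Thm. 21] — the
tree's `CRSSLPFeasible n k 3` (`WeightEnumeratorBounds.lean`), PROVED necessary for every `[[n,k,3]]` additive code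
without weight-one stabilizer words (`CRSS1998_theorem21_LP_holds`, `QuaternaryMacWilliams.lean`) and threaded to all
additive codes by shortening (`AdditiveCodeExists.exists_crssLPFeasible`, `LinearProgrammingBoundAdditive.lean`): the
first two are (19) at `j = 1, 2` (quaternary Krawtchouk `P_1(x) = 3n − 4x`, `2P_2(x) = (4x−3n+1)² − 3n − 1`), the third
is (20). So the file PROVES Theorem 3 for all three families, as theorems about `AdditiveCodeExists` (= «stabilizer code
`[[n,k,3]]`, degenerate or non-degenerate»), with NO named fact.

## Contents (all PROVED; no `sorry`; no new definitions)

1. `krawtchouk4_zero_cast`, `krawtchouk4_one_cast`, `two_mul_krawtchouk4_two_cast` — `P_0 = 1`, `P_1(r) = 3n − 4r`,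
   `2P_2(r) = 16r² − (24n − 8)r + 9n² − 9n` (`r ≤ n`).
2. `CRSSLPFeasible.three_moments` — from `CRSSLPFeasible n k 3`: `A_0 = 1`, `A_1 = 0`, `A_r ≥ 0`, `Σ A_r = 2^s`,
   `Σ (3n − 4r) A_r = 0` (eq. (lp1) with `A_1 = 0`), `Σ 2P_2(r) A_r = 2·2^s A_2` (eq. (lp2)), `2^s ≤ 2 Σ_{r even} A_r`
   (eq. (lp3)); `sum_quadratic_eq` — hence `Σ (αr² + βr + γ) A_r` in closed form; `sum_lowerBound_two_terms`.
3. `CRSSLPFeasible.three_hamming` — **the LP implies the Hamming inequality** `3n + 1 ≤ 2^{n−k}` for `n ≥ 5`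
   (polynomial `f`; used for the shortened lengths).
4. `CRSSLPFeasible.lt_of_f_length` (`n = f_{m+2} − 1`: `4c = 3n`, `c` odd ⇒ `3n + 4 < 2^{n−k}`, with the printed
   equality-case analysis «`A_i = 0` except `i = 0, l, l+1` … `1 + 3n/4 ≥ (3n+4)/2` which is impossible»),
   `CRSSLPFeasible.lt_of_8f_add_one_length` (`4c = 3n + 1`, `c` odd ⇒ `3n + 5 < 2^{n−k}`),
   `CRSSLPFeasible.lt_of_8f_add_two_length` (`4c = 3n + 2` ⇒ `3n + 2 < 2^{n−k}`).
5. **Theorem 3**: `YuEtAl2013_theorem3_f` (`n = f_{m+2} − 1 = (4^{m+2} − 1)/3 − 1`, `s_H = 2m + 4`: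
   `AdditiveCodeExists n k 3 → k + (2m + 5) ≤ n`), `YuEtAl2013_theorem3_8f_add_one` (`n = 8f_m + 1`, `s_H = 2m + 3`:
   `k + (2m + 4) ≤ n`), `YuEtAl2013_theorem3_8f_add_two` (`n = 8f_m + 2`, `s_H = 2m + 3`: `k + (2m + 4) ≤ n`), all
   `m ≥ 1`; instances `no_code_41_34_3`, `no_code_42_35_3`, `no_code_84_76_3` (the `n = 20` instance `k ≤ 13` is
   the census's kernel LP cell `Summit.Ventures.QEC.Census.NoCode.noCode_20_14`, not restated).
   The shortened branch (`[[m′,k,3]]`, `m′ < n`, LP-feasible at `m′`) is closed by item 3 at `m′`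
   (`m′ ≥ k + 4 ≥ 5` by the quantum Singleton bound `AdditiveCodeExists.quantumSingleton`) and
   `(3m′ + 1)·2^{n−m′} ≥ 6n − 4 > 3n + 5`.

Deliberately NOT here: the constructions (Thm. 2, the families `[2^m]`, `[8·m]`, pasting — lower column), the tables;
`s_H = ⌈log₂(3n+1)⌉` is quoted in words (the statements carry the explicit value `2m+4` / `2m+3`). Tree search
(2026-08-27): `CRSSLPFeasible`, `crssDual`, `krawtchouk4`, `CRSS1998_theorem21_LP_holds`, `CRSSLPFeasible.anti`,
`AdditiveCodeExists.exists_crssLPFeasible`, `AdditiveCodeExists.quantumSingleton`, `AdditiveCodeExists.le`,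
`krawtchouk4_at_zero` (QuantumHammingBoundGeneral) — reused; no analytic `d = 3` LP family existed; the `n ≤ 30`
instances `(9,·)`, `(10,·)`, `(20,·)` are kernel LP cells of the census (Summits-side), not restated as such.
-/

namespace Literature.InformationTheory.QuantumCodes

open Finset

/-! ### 1. The first three quaternary Krawtchouk polynomials -/

/-- `P_0(r,n) = 1`. [cite: CalderbankEtAl1998, §7 before Thm. 21 (Krawtchouk polynomials)] -/
theorem krawtchouk4_zero_cast (n r : ℕ) : (krawtchouk4 n 0 r : ℝ) = 1 := by
  simp [krawtchouk4]

/-- `P_1(r,n) = 3(n − r) − r = 3n − 4r` for `r ≤ n` («`A_1 = ⟨3n − 4x⟩`»).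
[cite: YuEtAl2013, §IV eq. (lp1) (chunk p0007 L24)] -/
theorem krawtchouk4_one_cast {n r : ℕ} (hr : r ≤ n) : (krawtchouk4 n 1 r : ℝ) = 3 * n - 4 * r := by
  simp [krawtchouk4, Finset.sum_range_succ, Nat.cast_sub hr]
  ring

/-- `2·P_2(r,n) = 9(n−r)(n−r−1) − 6r(n−r) + r(r−1) = 16r² − (24n − 8)r + 9n² − 9n = (4r − 3n + 1)² − 3n − 1` for
`r ≤ n` («`A_2 = ½⟨(4x − 3n + 1)² − 3n − 1⟩`»). [cite: YuEtAl2013, §IV eq. (lp2) (chunk p0007 L25)] -/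
theorem two_mul_krawtchouk4_two_cast {n r : ℕ} (hr : r ≤ n) :
    2 * (krawtchouk4 n 2 r : ℝ) = 16 * (r : ℝ) ^ 2 - (24 * n - 8) * r + (9 * (n : ℝ) ^ 2 - 9 * n) := by
  have h1 : ((r.choose 2 : ℕ) : ℝ) = r * (r - 1) / 2 := Nat.cast_choose_two (K := ℝ) r
  have h2 : (((n - r).choose 2 : ℕ) : ℝ) = (n - r : ℕ) * ((n - r : ℕ) - 1) / 2 := Nat.cast_choose_two (K := ℝ) _
  simp [krawtchouk4, Finset.sum_range_succ]
  rw [h1, h2, Nat.cast_sub hr]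
  ring

/-! ### 2. The restricted LP system at `d = 3`: moments -/

section LP

variable {n k : ℕ}

/-- **The three printed LP conditions, extracted from CRSS's system at `d = 3`.** If `CRSSLPFeasible n k 3` then there
are reals `A_0, …, A_n` with `A_0 = 1`, `A_1 = 0`, `A_r ≥ 0`, `Σ A_r = 2^s` (`s = n − k`), and
(lp1) `Σ_r (3n − 4r) A_r = 2^s A_1 = 0`, (lp2) `Σ_r 2P_2(r) A_r = 2·2^s A_2`, (lp3) `Σ_{r even} A_r ≥ 2^{s−1}`.
[cite: YuEtAl2013, §IV eqs. (lp1)–(lp3) (chunk p0007 L21-30); CalderbankEtAl1998, §7 Thm. 21 eqs. (16)–(20)] -/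
theorem CRSSLPFeasible.three_moments (h : CRSSLPFeasible n k 3) :
    ∃ A : ℕ → ℝ, A 0 = 1 ∧ A 1 = 0 ∧ (∀ j, j ≤ n → 0 ≤ A j) ∧
      ∑ r ∈ range (n + 1), A r = 2 ^ (n - k) ∧
      ∑ r ∈ range (n + 1), (3 * n - 4 * r : ℝ) * A r = 0 ∧
      ∑ r ∈ range (n + 1), (16 * (r : ℝ) ^ 2 - (24 * n - 8) * r + (9 * (n : ℝ) ^ 2 - 9 * n)) * A r
        = 2 * 2 ^ (n - k) * A 2 ∧
      (2 : ℝ) ^ (n - k) ≤ 2 * ∑ r ∈ (range (n + 1)).filter Even, A r := by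
  obtain ⟨A, h0, h1, hpos, hsum, heq, -, hpar, -⟩ := h
  have hT : (0 : ℝ) < 2 ^ (n - k) := by positivity
  refine ⟨A, h0, h1, hpos, hsum, ?_, ?_, ?_⟩
  · -- (19) at `j = 1`, with `A_1 = 0`
    have h := heq 1 (by norm_num)
    rw [h1, crssDual] at h
    have hS : ∑ r ∈ range (n + 1), (krawtchouk4 n 1 r : ℝ) * A r = 0 := by
      rcases mul_eq_zero.1 h.symm with h' | h'
      · exact absurd h' (by positivity)
      · exact h'
    rw [← hS]
    refine Finset.sum_congr rfl fun r hr => ?_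
    rw [krawtchouk4_one_cast (by have := Finset.mem_range.1 hr; omega)]
  · -- (19) at `j = 2`
    have h := heq 2 (by norm_num)
    rw [crssDual] at h
    have hS : ∑ r ∈ range (n + 1), (krawtchouk4 n 2 r : ℝ) * A r = 2 ^ (n - k) * A 2 := by
      rw [h]
      field_simp
    calc ∑ r ∈ range (n + 1), (16 * (r : ℝ) ^ 2 - (24 * n - 8) * r + (9 * (n : ℝ) ^ 2 - 9 * n)) * A r
        = ∑ r ∈ range (n + 1), 2 * ((krawtchouk4 n 2 r : ℝ) * A r) := by
          refine Finset.sum_congr rfl fun r hr => ?_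
          rw [← mul_assoc, two_mul_krawtchouk4_two_cast (by have := Finset.mem_range.1 hr; omega)]
      _ = 2 * 2 ^ (n - k) * A 2 := by rw [← Finset.mul_sum, hS, mul_assoc]
  · -- (20)
    rcases hpar with h | h
    · exact h.symm.le
    · rw [h]
      linarith

/-- **Closed form of a quadratic average.** With the moments of `CRSSLPFeasible.three_moments`
(`Σ A_r = T`, `Σ (3n−4r)A_r = 0`, `Σ 2P_2(r) A_r = 2TA_2`):
`Σ_r (αr² + βr + γ) A_r = (α/16)(2TA_2 + (9n² + 3n)T) + β·(3n/4)T + γT`.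
[cite: YuEtAl2013, §IV proof of Thm. 3 (chunk p0007: «⟨h(x)⟩ = 3n + 2A_1 + 2A_2», «⟨f(x)⟩ = 3n+1+4A_1+2A_2», «⟨g(x)⟩ = 3n−4+2A_1+2A_2»)] -/
theorem sum_quadratic_eq {A : ℕ → ℝ} {T : ℝ} (hM0 : ∑ r ∈ range (n + 1), A r = T)
    (hM1 : ∑ r ∈ range (n + 1), (3 * n - 4 * r : ℝ) * A r = 0)
    (hM2 : ∑ r ∈ range (n + 1), (16 * (r : ℝ) ^ 2 - (24 * n - 8) * r + (9 * (n : ℝ) ^ 2 - 9 * n)) * A r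
      = 2 * T * A 2)
    (α β γ : ℝ) :
    ∑ r ∈ range (n + 1), (α * (r : ℝ) ^ 2 + β * r + γ) * A r
      = α / 16 * (2 * T * A 2 + (9 * (n : ℝ) ^ 2 + 3 * n) * T) + β * (3 * n / 4 * T) + γ * T := by
  -- the linear moments
  set S0 := ∑ r ∈ range (n + 1), A r
  set S1 := ∑ r ∈ range (n + 1), (r : ℝ) * A r
  set S2 := ∑ r ∈ range (n + 1), (r : ℝ) ^ 2 * A r
  have e1 : ∑ r ∈ range (n + 1), (3 * n - 4 * r : ℝ) * A r = 3 * n * S0 - 4 * S1 := by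
    simp only [S0, S1, Finset.mul_sum, ← Finset.sum_sub_distrib]
    exact Finset.sum_congr rfl fun r _ => by ring
  have e2 : ∑ r ∈ range (n + 1), (16 * (r : ℝ) ^ 2 - (24 * n - 8) * r + (9 * (n : ℝ) ^ 2 - 9 * n)) * A r
      = 16 * S2 - (24 * n - 8) * S1 + (9 * (n : ℝ) ^ 2 - 9 * n) * S0 := by
    simp only [S0, S1, S2, Finset.mul_sum, ← Finset.sum_sub_distrib, ← Finset.sum_add_distrib]
    exact Finset.sum_congr rfl fun r _ => by ring
  have e3 : ∑ r ∈ range (n + 1), (α * (r : ℝ) ^ 2 + β * r + γ) * A r = α * S2 + β * S1 + γ * S0 := by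
    simp only [S0, S1, S2, Finset.mul_sum, ← Finset.sum_add_distrib]
    exact Finset.sum_congr rfl fun r _ => by ring
  rw [e1, hM0] at hM1
  rw [e2, hM0] at hM2
  rw [e3, hM0]
  have hS1 : S1 = 3 * n / 4 * T := by linarith
  rw [hS1] at hM2 ⊢
  have hS2 : 16 * S2 = 2 * T * A 2 + (9 * (n : ℝ) ^ 2 + 3 * n) * T := by linear_combination hM2
  linear_combination (α / 16) * hS2

/-- **Dropping nonnegative terms**: if `A_1 = 0`, `A_r ≥ 0`, and `F(r) ≥ 0` for `3 ≤ r ≤ n`, then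
`Σ_{r=0}^{n} F(r)A_r ≥ F(0)A_0 + F(2)A_2` (the step «`2^s⟨h(x)⟩ = Σ h(i)A_i ≥ h(0) + h(1)A_1 + h(2)A_2`»).
[cite: YuEtAl2013, §IV proof of Thm. 3 (chunk p0007 L52-55)] -/
theorem sum_lowerBound_two_terms (hn : 2 ≤ n) {A : ℕ → ℝ} (F : ℕ → ℝ) (h1 : A 1 = 0)
    (hpos : ∀ j, j ≤ n → 0 ≤ A j) (hF : ∀ r, 3 ≤ r → r ≤ n → 0 ≤ F r) :
    F 0 * A 0 + F 2 * A 2 ≤ ∑ r ∈ range (n + 1), F r * A r := by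
  have hsub : ({0, 2} : Finset ℕ) ⊆ range (n + 1) := by
    intro x hx
    simp only [mem_insert, mem_singleton] at hx
    rw [mem_range]; omega
  calc F 0 * A 0 + F 2 * A 2 = ∑ r ∈ ({0, 2} : Finset ℕ), F r * A r :=
        (sum_pair (f := fun r => F r * A r) (show (0 : ℕ) ≠ 2 by norm_num)).symm
    _ ≤ ∑ r ∈ range (n + 1), F r * A r := sum_le_sum_of_subset_of_nonneg hsub fun r hr hrs => by
        rw [mem_range] at hr
        simp only [mem_insert, mem_singleton, not_or] at hrs
        by_cases hr1 : r = 1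
        · rw [hr1, h1, mul_zero]
        · exact mul_nonneg (hF r (by omega) (by omega)) (hpos r (by omega))

/-- Integers outside the open unit interval `(c, c+1)`: `(r − c)(r − c − 1) ≥ 0` for naturals `r, c` (the printed
«`h(x)` is nonnegative for all integers» since its zeros `3n/4`, `3n/4 + 1` are consecutive integers).
[cite: YuEtAl2013, §IV proof of Thm. 3 (chunk p0007 L40-43)] -/
theorem consecutive_root_product_nonneg (r c : ℕ) : 0 ≤ ((r : ℝ) - c) * ((r : ℝ) - c - 1) := by
  rcases Nat.lt_or_ge r (c + 1) with h | h
  · have h' : (r : ℝ) ≤ c := by exact_mod_cast Nat.lt_succ_iff.1 h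
    exact mul_nonneg_of_nonpos_of_nonpos (by linarith) (by linarith)
  · have h' : (c : ℝ) + 1 ≤ r := by exact_mod_cast h
    exact mul_nonneg (by linarith) (by linarith)

/-- … and strictly positive off the two roots: `(r − c)(r − c − 1) ≥ 2 > 0` for `r ∉ {c, c+1}`.
[cite: YuEtAl2013, §IV proof of Thm. 3 (chunk p0007 L57-58: «l, l+1 are the only zeros of h(x)»)] -/
theorem consecutive_root_product_pos {r c : ℕ} (hc : r ≠ c) (hc1 : r ≠ c + 1) :
    0 < ((r : ℝ) - c) * ((r : ℝ) - c - 1) := by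
  rcases Nat.lt_or_ge r c with h | h
  · have h' : (r : ℝ) + 1 ≤ c := by exact_mod_cast h
    exact mul_pos_of_neg_of_neg (by linarith) (by linarith)
  · have h2 : c + 2 ≤ r := by omega
    have h' : (c : ℝ) + 2 ≤ r := by exact_mod_cast h2
    exact mul_pos (by linarith) (by linarith)

/-! ### 3. The LP implies the Hamming inequality (no weight-one words; used on shortened lengths) -/

/-- **Hamming inequality from the restricted LP**: `CRSSLPFeasible n k 3` and `n ≥ 5` imply `3n + 1 ≤ 2^{n−k}`. Proof
with Yu et al.'s square `f(x) = (4x − 3n − 1)² ≥ 0`: `Σ f(r)A_r = 2^s(2A_2 + 3n + 1) ≥ f(0) + f(2)A_2 =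
(3n+1)² + (3n−7)²A_2`, and `(3n−7)² ≥ 2(3n+1)` for `n ≥ 5`. (The purity-free Hamming bound for codes without
weight-one stabilizer words; degenerate `A_2 > 0` allowed.) [cite: YuEtAl2013, §IV proof of Thm. 3, second case (chunk p0007 L62-90, the function f)] -/
theorem CRSSLPFeasible.three_hamming (h : CRSSLPFeasible n k 3) (hn : 5 ≤ n) :
    (3 * n + 1 : ℝ) ≤ 2 ^ (n - k) := by
  obtain ⟨A, h0, h1, hpos, hM0, hM1, hM2, -⟩ := h.three_moments
  set T : ℝ := 2 ^ (n - k) with hT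
  have hn' : (5 : ℝ) ≤ n := by exact_mod_cast hn
  -- `f(r) = 16 r² − 8(3n+1) r + (3n+1)²`
  have hX := sum_quadratic_eq hM0 hM1 hM2 16 (-(8 * (3 * n + 1))) ((3 * n + 1) ^ 2)
  have hlow := sum_lowerBound_two_terms (by omega) (A := A)
    (fun r => 16 * (r : ℝ) ^ 2 + -(8 * (3 * n + 1)) * r + (3 * n + 1) ^ 2) h1 hpos
    (fun r _ _ => by nlinarith [sq_nonneg (4 * (r : ℝ) - 3 * n - 1)])
  rw [hX, h0] at hlow
  have hA2 : 0 ≤ A 2 := hpos 2 (by omega)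
  by_contra hlt
  rw [not_le] at hlt
  -- `T(2A_2 + 3n + 1) < (3n+1)(2A_2 + 3n+1) ≤ (3n+1)² + (3n−7)² A_2`
  have h3 : T * (2 * A 2 + 3 * n + 1) < (3 * n + 1) * (2 * A 2 + 3 * n + 1) :=
    mul_lt_mul_of_pos_right hlt (by linarith)
  have h4 : (6 * n + 2) * A 2 ≤ (3 * n - 7) ^ 2 * A 2 :=
    mul_le_mul_of_nonneg_right (by nlinarith) hA2
  nlinarith

/-! ### 4. The three families (LP level) -/

/-- **Family `n = 8f_m + 1`** (LP level): if `4c = 3n + 1` with `c` odd (for `n = 8f_m + 1`, `c = 2^{2m+1} − 1`) and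
`n ≥ 5`, then `CRSSLPFeasible n k 3` forces `2^{n−k} > 3n + 5`. Printed proof: `f(x) = 16(x − (3n+1)/4)²`;
«`f(0) = (3n+1)² > (3n+5)(3n−7) + 16`, `f(1) = (3n−3)² > 4(3n+5)`, `f(2) = (3n−7)² > 2(3n+5) + 16`» and, by (lp3),
«`16A_0 + 16A_2 + Σ_{i≥2} f(2i)A_{2i} ≥ 16 Σ A_{2i} ≥ 8·2^s` where we have used `f(2i) ≥ 16` since `(3n+1)/4`, the
unique zero of `f(x)`, is an odd integer»; whence `2^s⟨f⟩ > (3n+5)⟨f − 8⟩ + 8·2^s`, i.e. `2^s > 3n + 5`.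
[cite: YuEtAl2013, §IV proof of Thm. 3, case n = 8f_m + 1 (chunk p0007 L62-91)] -/
theorem CRSSLPFeasible.lt_of_8f_add_one_length (h : CRSSLPFeasible n k 3) {c : ℕ} (hc : 4 * c = 3 * n + 1)
    (hodd : Odd c) (hn : 5 ≤ n) : (3 * n + 5 : ℝ) < 2 ^ (n - k) := by
  obtain ⟨A, h0, h1, hpos, hM0, hM1, hM2, hE⟩ := h.three_moments
  set T : ℝ := 2 ^ (n - k) with hT
  set E : ℝ := ∑ r ∈ (range (n + 1)).filter Even, A r with hEdef
  have hn' : (5 : ℝ) ≤ n := by exact_mod_cast hn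
  have hc' : (4 : ℝ) * c = 3 * n + 1 := by exact_mod_cast hc
  -- `f` and `f − 16·[even]`
  let f : ℕ → ℝ := fun r => 16 * (r : ℝ) ^ 2 + -(8 * (3 * n + 1)) * r + (3 * n + 1) ^ 2
  have hX := sum_quadratic_eq hM0 hM1 hM2 16 (-(8 * (3 * n + 1))) ((3 * n + 1) ^ 2)
  -- `Σ 16·[r even] A_r = 16 E`
  have hEsum : ∑ r ∈ range (n + 1), (16 * if Even r then (1 : ℝ) else 0) * A r = 16 * E := by
    rw [hEdef, Finset.sum_filter, Finset.mul_sum]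
    refine Finset.sum_congr rfl fun r _ => ?_
    split_ifs <;> ring
  -- the corrected function is nonnegative for `r ≥ 3` (indeed for all `r`): `f(r) = (4r − 4c)²`, `≥ 16` off `c`
  have hlow := sum_lowerBound_two_terms (by omega) (A := A)
    (fun r => f r - 16 * if Even r then (1 : ℝ) else 0) h1 hpos (fun r _ _ => by
      have hf : f r = (4 * (r : ℝ) - 4 * c) ^ 2 := by simp only [f]; nlinarith [hc']
      rw [hf]
      split_ifs with hr
      · -- `r` even, `c` odd: `r ≠ c`
        have hrc : r ≠ c := fun h => (Nat.not_even_iff_odd.2 hodd) (h ▸ hr)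
        rcases Nat.lt_or_gt_of_ne hrc with hlt | hgt
        · have : (r : ℝ) + 1 ≤ c := by exact_mod_cast hlt
          nlinarith
        · have : (c : ℝ) + 1 ≤ r := by exact_mod_cast hgt
          nlinarith
      · simp only [mul_zero, sub_zero]; positivity)
  have hsplit : ∑ r ∈ range (n + 1), (f r - 16 * if Even r then (1 : ℝ) else 0) * A r
      = ∑ r ∈ range (n + 1), (16 * (r : ℝ) ^ 2 + -(8 * (3 * n + 1)) * r + (3 * n + 1) ^ 2) * A r - 16 * E := by
    rw [← hEsum, ← Finset.sum_sub_distrib]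
    exact Finset.sum_congr rfl fun r _ => by simp only [f]; ring
  rw [hsplit, hX, h0] at hlow
  simp only [f, Nat.cast_zero, Nat.cast_ofNat, Even.zero, if_true, show Even (2 : ℕ) from ⟨1, rfl⟩] at hlow
  have hA2 : 0 ≤ A 2 := hpos 2 (by omega)
  by_contra hle
  rw [not_lt] at hle
  -- `T(2A_2 + 3n − 7) ≤ (3n+5)(2A_2 + 3n − 7)`
  have h3 : T * (2 * A 2 + 3 * n - 7) ≤ (3 * n + 5) * (2 * A 2 + 3 * n - 7) :=
    mul_le_mul_of_nonneg_right hle (by linarith)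
  have h4 : 0 ≤ (9 * (n : ℝ) ^ 2 - 48 * n + 23) * A 2 := mul_nonneg (by nlinarith) hA2
  nlinarith

/-- **Family `n = 8f_m + 2`** (LP level): if `4c = 3n + 2` (for `n = 8f_m + 2`, `c = 2^{2m+1}`) and `n ≥ 5`, then
`CRSSLPFeasible n k 3` forces `2^{n−k} > 3n + 2`. Printed proof: `g(x) = 16(x − (3n+2)/4)(x − (3n−2)/4)` «is
nonnegative for integer `x`. It is obvious that `g(0) > (3n+2)(3n−4)` and `g(i) > 2(3n+2)` for `i = 1,2` as long as
`n ≥ 5` … `⟨g(x)⟩ = 3n − 4 + 2A_1 + 2A_2`. Thus `2^s⟨g(x)⟩ ≥ g(0) + g(1)A_1 + g(2)A_2 > (3n+2)⟨g(x)⟩` … we have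
`2^s > 3n + 2 = 2^{s_H}`». [cite: YuEtAl2013, §IV proof of Thm. 3, case n = 8f_m + 2 (chunk p0007 L93-115)] -/
theorem CRSSLPFeasible.lt_of_8f_add_two_length (h : CRSSLPFeasible n k 3) {c : ℕ} (hc : 4 * c = 3 * n + 2)
    (hn : 5 ≤ n) : (3 * n + 2 : ℝ) < 2 ^ (n - k) := by
  obtain ⟨A, h0, h1, hpos, hM0, hM1, hM2, -⟩ := h.three_moments
  set T : ℝ := 2 ^ (n - k) with hT
  have hn' : (5 : ℝ) ≤ n := by exact_mod_cast hn
  have hc' : (4 : ℝ) * c = 3 * n + 2 := by exact_mod_cast hc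
  -- `g(r) = 16 r² − 24 n r + (9n² − 4) = (4r − 4c)(4r − 4c + 4)`
  have hX := sum_quadratic_eq hM0 hM1 hM2 16 (-(24 * n)) (9 * (n : ℝ) ^ 2 - 4)
  have hlow := sum_lowerBound_two_terms (by omega) (A := A)
    (fun r => 16 * (r : ℝ) ^ 2 + -(24 * (n : ℝ)) * r + (9 * (n : ℝ) ^ 2 - 4)) h1 hpos (fun r _ _ => by
      have hg : 16 * (r : ℝ) ^ 2 + -(24 * (n : ℝ)) * r + (9 * (n : ℝ) ^ 2 - 4)
          = 16 * (((r : ℝ) - c) * ((r : ℝ) - c + 1)) := by nlinarith [hc']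
      rw [hg]
      have := consecutive_root_product_nonneg r (c - 1)
      rcases Nat.eq_zero_or_pos c with hc0 | hcpos
      · subst hc0; simp at hc'; linarith
      · rw [Nat.cast_sub (by omega : 1 ≤ c), Nat.cast_one] at this
        nlinarith [this])
  rw [hX, h0] at hlow
  simp only [Nat.cast_zero, Nat.cast_ofNat] at hlow
  have hA2 : 0 ≤ A 2 := hpos 2 (by omega)
  by_contra hle
  rw [not_lt] at hle
  have h3 : T * (2 * A 2 + 3 * n - 4) ≤ (3 * n + 2) * (2 * A 2 + 3 * n - 4) :=
    mul_le_mul_of_nonneg_right hle (by linarith)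
  have h4 : 0 ≤ (9 * (n : ℝ) ^ 2 - 54 * n + 56) * A 2 := mul_nonneg (by nlinarith) hA2
  nlinarith

/-- **Family `n = f_{m+2} − 1`** (LP level): if `4c = 3n` with `c` odd (for `n = f_{m+2} − 1`, `c = 4^{m+1} − 1`) and
`n ≥ 5`, then `CRSSLPFeasible n k 3` forces `2^{n−k} > 3n + 4`. Printed proof: `h(x) = 16(x − 3n/4)(x − 1 − 3n/4)`
nonnegative on the integers, `h(0) = 3n(3n+4)`, `h(2) = (3n−4)(3n−8) ≥ 2(3n+4)`, `⟨h⟩ = 3n + 2A_1 + 2A_2`, so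
`2^s ≥ 3n + 4`; «We shall now prove that the equality can never happen. If the equality were true, i.e.,
`2^s = 3n + 4`, then all the inequalities … would become equalities which means that `A_i = 0` except `i = 0, l, l+1`
where `l = 3n/4` … From conditions `1 + A_l + A_{l+1} = 3n + 4` and `3n − 4A_{l+1} = 0` … we can solve
`A_{l+1} = 3n/4` … Noticing that `l = 4^{m+1} − 1` is odd it follows from inequality (lp3) that `1 + 3n/4 ≥ (3n+4)/2`
which is impossible. Thus `2^s > 3n + 4`.» [cite: YuEtAl2013, §IV proof of Thm. 3, case n = f_{m+2} − 1 (chunk p0007 L34-60)] -/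
theorem CRSSLPFeasible.lt_of_f_length (h : CRSSLPFeasible n k 3) {c : ℕ} (hc : 4 * c = 3 * n) (hodd : Odd c)
    (hn : 5 ≤ n) : (3 * n + 4 : ℝ) < 2 ^ (n - k) := by
  obtain ⟨A, h0, h1, hpos, hM0, hM1, hM2, hE⟩ := h.three_moments
  set T : ℝ := 2 ^ (n - k) with hT
  have hn' : (5 : ℝ) ≤ n := by exact_mod_cast hn
  have hc' : (4 : ℝ) * c = 3 * n := by exact_mod_cast hc
  have hc3 : 3 ≤ c := by omega
  have hcn : c + 1 ≤ n := by omega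
  -- `h(r) = 16 r² − (24n + 16) r + (9n² + 12n) = 16 (r − c)(r − c − 1)`
  let hh : ℕ → ℝ := fun r => 16 * (r : ℝ) ^ 2 + -(24 * (n : ℝ) + 16) * r + (9 * (n : ℝ) ^ 2 + 12 * n)
  have hh_eq : ∀ r : ℕ, hh r = 16 * (((r : ℝ) - c) * ((r : ℝ) - c - 1)) := fun r => by
    simp only [hh]; nlinarith [hc']
  have hh_nonneg : ∀ r : ℕ, 0 ≤ hh r := fun r => by
    rw [hh_eq]; nlinarith [consecutive_root_product_nonneg r c]
  have hX := sum_quadratic_eq hM0 hM1 hM2 16 (-(24 * (n : ℝ) + 16)) (9 * (n : ℝ) ^ 2 + 12 * n)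
  have hlow := sum_lowerBound_two_terms (by omega) (A := A) hh h1 hpos (fun r _ _ => hh_nonneg r)
  have hX' : ∑ r ∈ range (n + 1), hh r * A r = 2 * T * A 2 + 3 * n * T := by
    simp only [hh]; rw [hX]; ring
  rw [hX', h0] at hlow
  simp only [hh, Nat.cast_zero, Nat.cast_ofNat] at hlow
  have hA2 : 0 ≤ A 2 := hpos 2 (by omega)
  by_contra hle
  rw [not_lt] at hle
  -- Step 1: `T = 3n + 4` and `A_2 = 0`
  have h3 : T * (2 * A 2 + 3 * n) ≤ (3 * n + 4) * (2 * A 2 + 3 * n) :=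
    mul_le_mul_of_nonneg_right hle (by linarith)
  have hcoef : 0 < 9 * (n : ℝ) ^ 2 - 42 * n + 24 := by nlinarith
  have hA2z : A 2 = 0 := by
    by_contra hne
    have hA2p : 0 < A 2 := lt_of_le_of_ne hA2 (Ne.symm hne)
    nlinarith [mul_pos hcoef hA2p]
  have hTeq : T = 3 * n + 4 := by
    refine le_antisymm hle ?_
    rw [hA2z] at hlow
    nlinarith
  -- Step 2: every term `h(r) A_r`, `r ≠ 0`, vanishes
  have hsum0 : ∑ r ∈ (range (n + 1)).erase 0, hh r * A r = 0 := by
    have h := Finset.add_sum_erase (range (n + 1)) (fun r => hh r * A r) (by simp : 0 ∈ range (n + 1))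
    rw [hX', hA2z, hTeq, h0] at h
    simp only [hh, Nat.cast_zero] at h
    have : ∑ x ∈ (range (n + 1)).erase 0, hh x * A x
        = ∑ x ∈ (range (n + 1)).erase 0,
          (16 * (x : ℝ) ^ 2 + -(24 * (n : ℝ) + 16) * x + (9 * (n : ℝ) ^ 2 + 12 * n)) * A x := rfl
    rw [this]
    linarith
  have hterm : ∀ r ∈ (range (n + 1)).erase 0, hh r * A r = 0 :=
    (Finset.sum_eq_zero_iff_of_nonneg fun r hr => mul_nonneg (hh_nonneg r)
      (hpos r (by have := Finset.mem_range.1 (Finset.mem_of_mem_erase hr); omega))).1 hsum0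
  -- hence `A_r = 0` off `{0, c, c+1}`
  have hA0 : ∀ r, r ≤ n → r ≠ 0 → r ≠ c → r ≠ c + 1 → A r = 0 := by
    intro r hrn hr0 hrc hrc1
    have h := hterm r (Finset.mem_erase.2 ⟨hr0, Finset.mem_range.2 (by omega)⟩)
    rcases mul_eq_zero.1 h with h' | h'
    · exfalso
      rw [hh_eq] at h'
      have := consecutive_root_product_pos hrc hrc1
      linarith
    · exact h'
  -- Step 3: the three surviving unknowns
  have hsub3 : ({0, c, c + 1} : Finset ℕ) ⊆ range (n + 1) := by
    intro x hx
    simp only [mem_insert, mem_singleton] at hx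
    rw [mem_range]; omega
  have hvan : ∀ (g : ℕ → ℝ), ∀ x ∈ range (n + 1), x ∉ ({0, c, c + 1} : Finset ℕ) → g x * A x = 0 := by
    intro g x hx hx3
    simp only [mem_insert, mem_singleton, not_or] at hx3
    rw [hA0 x (by have := mem_range.1 hx; omega) hx3.1 hx3.2.1 hx3.2.2, mul_zero]
  have hthree : ∀ g : ℕ → ℝ, ∑ r ∈ range (n + 1), g r * A r = g 0 * A 0 + g c * A c + g (c + 1) * A (c + 1) := by
    intro g
    rw [← Finset.sum_subset hsub3 (hvan g), Finset.sum_insert (by simp; omega),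
      Finset.sum_pair (by omega), add_assoc]
  -- `Σ A_r = 3n + 4`
  have e0 := hM0
  rw [show ∑ r ∈ range (n + 1), A r = ∑ r ∈ range (n + 1), (fun _ => (1 : ℝ)) r * A r by simp, hthree,
    h0] at e0
  -- `Σ (3n − 4r) A_r = 0`
  have e1 := hM1
  rw [hthree (fun r => (3 * n - 4 * r : ℝ)), h0] at e1
  have hc1' : ((c + 1 : ℕ) : ℝ) = c + 1 := by push_cast; ring
  simp only [Nat.cast_zero, hc1'] at e1
  -- the even-weight sum is `A_0 + A_{c+1}` (`c` odd)
  have hEven : ∑ r ∈ (range (n + 1)).filter Even, A r = A 0 + A (c + 1) := by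
    have hsub2 : ({0, c + 1} : Finset ℕ) ⊆ (range (n + 1)).filter Even := by
      intro x hx
      simp only [mem_insert, mem_singleton] at hx
      rw [mem_filter, mem_range]
      rcases hx with rfl | rfl
      · exact ⟨by omega, Even.zero⟩
      · exact ⟨by omega, hodd.add_one⟩
    rw [← Finset.sum_subset hsub2 fun x hx hx2 => ?_, Finset.sum_pair (by omega)]
    simp only [mem_insert, mem_singleton, not_or] at hx2
    rw [mem_filter, mem_range] at hx
    refine hA0 x (by omega) hx2.1 (fun hxc => ?_) hx2.2
    exact (Nat.not_even_iff_odd.2 hodd) (hxc ▸ hx.2)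
  rw [hEven, h0] at hE
  -- `A_{c+1} = 3n/4`, `1 + A_c + A_{c+1} = 3n+4`, `3n+4 ≤ 2(1 + A_{c+1})`
  have : T = 3 * n + 4 := hTeq
  nlinarith [hc']

end LP

/-! ### 5. Arithmetic of the shortened branch -/

/-- `(3a + 1)·2^j ≥ 6(a + j) − 4` for `a, j ≥ 1`: a shortened length `m′ = n − j` satisfying the Hamming inequality
makes `2^{n−k} ≥ 6n − 4`, far above `3n + 5`. [folklore] -/
private theorem six_mul_le_hamming_shift {a j : ℕ} (ha : 1 ≤ a) (hj : 1 ≤ j) :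
    6 * (a + j) ≤ (3 * a + 1) * 2 ^ j + 4 := by
  induction j with
  | zero => omega
  | succ i ih =>
    rcases Nat.eq_zero_or_pos i with hi | hi
    · subst hi; omega
    · have := ih hi
      rw [pow_succ]
      nlinarith

/-- **The LP dichotomy for `[[n,k,3]]`** (CRSS Thm. 21 with Thm. 6 (e), specialised): an `[[n,k,3]]` additive code with
`k ≥ 1` either has CRSS's system feasible at its own length `n`, or — after shortening at weight-one stabilizer words to
some `[[m′,k,3]]`, `k + 4 ≤ m′ < n` (quantum Singleton), where the system is feasible and gives `3m′+1 ≤ 2^{m′−k}` —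
satisfies `2^{n−k} ≥ 6n − 4`. [cite: CalderbankEtAl1998, §7 Thm. 21 with §4 Thm. 6 (e) (printed pp. 13, 26); YuEtAl2013, §IV Thm. 3 («degenerate or non-degenerate»)] -/
theorem AdditiveCodeExists.crssLP_three_or_large {n k : ℕ} (h : AdditiveCodeExists n k 3) (hk : 1 ≤ k) :
    CRSSLPFeasible n k 3 ∨ 6 * n ≤ 2 ^ (n - k) + 4 := by
  obtain ⟨m', hm'n, hcode, hlp⟩ := h.exists_crssLPFeasible
  rcases Nat.eq_or_lt_of_le hm'n with rfl | hlt
  · exact Or.inl hlp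
  · right
    have hsing := hcode.quantumSingleton hk
    have hkm : k ≤ m' := hcode.le
    have hH := hlp.three_hamming (by omega)
    have hH' : 3 * m' + 1 ≤ 2 ^ (m' - k) := by exact_mod_cast hH
    obtain ⟨j, hj⟩ : ∃ j, n = m' + j := ⟨n - m', by omega⟩
    have hj1 : 1 ≤ j := by omega
    have hpow : 2 ^ (n - k) = 2 ^ (m' - k) * 2 ^ j := by
      rw [← pow_add]; congr 1; omega
    have h6 := six_mul_le_hamming_shift (a := m') (by omega) hj1
    rw [hpow, hj]
    calc 6 * (m' + j) ≤ (3 * m' + 1) * 2 ^ j + 4 := h6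
      _ ≤ 2 ^ (m' - k) * 2 ^ j + 4 := by gcongr

/-! ### 6. Theorem 3 -/

/-- `4^j ≡ 1 (mod 3)`. [folklore] -/
private theorem four_pow_mod_three (j : ℕ) : 4 ^ j % 3 = 1 := by
  rw [Nat.pow_mod]; norm_num

/-- **Theorem 3, lengths `n = f_{m+2} − 1 = (4^{m+2} − 1)/3 − 1`** (`m ≥ 1`; `n = 20, 84, 340, …`; here
`3n + 4 = 2^{2m+4}` so `s_H = ⌈log₂(3n+1)⌉ = 2m + 4`): every `[[n,k,3]]` stabilizer code, degenerate or non-degenerate,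
has `n − k ≥ s_H + 1 = 2m + 5`. [cite: YuEtAl2013, §IV Thm. 3 (chunk p0007 L31-33), case n = f_{m+2} − 1] -/
theorem YuEtAl2013_theorem3_f {m k : ℕ} (hm : 1 ≤ m) (h : AdditiveCodeExists ((4 ^ (m + 2) - 1) / 3 - 1) k 3) :
    k + (2 * m + 5) ≤ (4 ^ (m + 2) - 1) / 3 - 1 := by
  set n := (4 ^ (m + 2) - 1) / 3 - 1 with hn
  have hmod := four_pow_mod_three (m + 2)
  have h64 : 64 ≤ 4 ^ (m + 2) := by
    calc (64 : ℕ) = 4 ^ 3 := by norm_num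
      _ ≤ 4 ^ (m + 2) := Nat.pow_le_pow_right (by norm_num) (by omega)
  have h3n : 3 * n + 4 = 4 ^ (m + 2) := by omega
  have h2pow : (2 : ℕ) ^ (2 * m + 4) = 4 ^ (m + 2) := by
    rw [show 2 * m + 4 = 2 * (m + 2) by ring, pow_mul]; norm_num
  -- `n ≥ 2m + 5` (the `k = 0` case)
  have hn_ge : 2 * m + 5 ≤ n := by
    have : 3 * (2 * m + 5) + 4 ≤ 4 ^ (m + 2) := by
      have h' : ∀ t : ℕ, 1 ≤ t → 3 * (2 * t + 5) + 4 ≤ 4 ^ (t + 2) := fun t ht => by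
        induction t with
        | zero => omega
        | succ i ih =>
          rcases Nat.eq_zero_or_pos i with hi | hi
          · subst hi; norm_num
          · have := ih hi
            rw [show i + 1 + 2 = (i + 2) + 1 by ring, pow_succ]; omega
      exact h' m hm
    omega
  rcases Nat.eq_zero_or_pos k with hk0 | hk
  · omega
  -- `c = 3n/4 = 4^{m+1} − 1`, odd
  have hc4 : 4 * (4 ^ (m + 1) - 1) = 3 * n := by
    have : 4 ^ (m + 2) = 4 * 4 ^ (m + 1) := by rw [pow_succ, mul_comm]
    have h1 : 1 ≤ 4 ^ (m + 1) := Nat.one_le_pow _ _ (by norm_num)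
    omega
  have hodd : Odd (4 ^ (m + 1) - 1) := by
    have heven : Even (4 ^ (m + 1)) := (show Even 4 by decide).pow_of_ne_zero (by omega)
    have h1 : 1 ≤ 4 ^ (m + 1) := Nat.one_le_pow _ _ (by norm_num)
    obtain ⟨t, ht⟩ := heven
    exact ⟨t - 1, by omega⟩
  -- `2^{n−k} > 3n + 4 = 2^{2m+4}`
  have hlt : 2 ^ (2 * m + 4) < 2 ^ (n - k) := by
    rw [h2pow, ← h3n]
    rcases h.crssLP_three_or_large hk with hlp | hbig
    · have := hlp.lt_of_f_length hc4 hodd (by omega)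
      exact_mod_cast this
    · omega
  have := (Nat.pow_lt_pow_iff_right (by norm_num : 1 < 2)).1 hlt
  omega

/-- **Theorem 3, lengths `n = 8f_m + 1 = 8(4^m − 1)/3 + 1`** (`m ≥ 1`; `n = 9, 41, 169, …`; `3n + 5 = 2^{2m+3}`,
`s_H = 2m + 3`): every `[[n,k,3]]` stabilizer code, degenerate or non-degenerate, has `n − k ≥ s_H + 1 = 2m + 4`.
[cite: YuEtAl2013, §IV Thm. 3 (chunk p0007 L31-33), case n = 8f_m + 1] -/
theorem YuEtAl2013_theorem3_8f_add_one {m k : ℕ} (hm : 1 ≤ m) (h : AdditiveCodeExists (8 * (4 ^ m - 1) / 3 + 1) k 3) :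
    k + (2 * m + 4) ≤ 8 * (4 ^ m - 1) / 3 + 1 := by
  set n := 8 * (4 ^ m - 1) / 3 + 1 with hn
  have hmod := four_pow_mod_three m
  have h4 : 4 ≤ 4 ^ m := by
    calc (4 : ℕ) = 4 ^ 1 := by norm_num
      _ ≤ 4 ^ m := Nat.pow_le_pow_right (by norm_num) hm
  have h3n : 3 * n + 5 = 8 * 4 ^ m := by omega
  have h2pow : (2 : ℕ) ^ (2 * m + 3) = 8 * 4 ^ m := by
    rw [pow_add, pow_mul]; norm_num; ring
  have hn_ge : 2 * m + 4 ≤ n := by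
    have h' : ∀ t : ℕ, 1 ≤ t → 3 * (2 * t + 4) + 5 ≤ 8 * 4 ^ t := fun t ht => by
      induction t with
      | zero => omega
      | succ i ih =>
        rcases Nat.eq_zero_or_pos i with hi | hi
        · subst hi; norm_num
        · have := ih hi; rw [pow_succ]; omega
    have := h' m hm
    omega
  rcases Nat.eq_zero_or_pos k with hk0 | hk
  · omega
  -- `c = (3n+1)/4 = 2·4^m − 1`, odd
  have hc4 : 4 * (2 * 4 ^ m - 1) = 3 * n + 1 := by omega
  have hodd : Odd (2 * 4 ^ m - 1) := ⟨4 ^ m - 1, by omega⟩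
  have hlt : 2 ^ (2 * m + 3) < 2 ^ (n - k) := by
    rw [h2pow, ← h3n]
    rcases h.crssLP_three_or_large hk with hlp | hbig
    · have := hlp.lt_of_8f_add_one_length hc4 hodd (by omega)
      exact_mod_cast this
    · omega
  have := (Nat.pow_lt_pow_iff_right (by norm_num : 1 < 2)).1 hlt
  omega

/-- **Theorem 3, lengths `n = 8f_m + 2 = 8(4^m − 1)/3 + 2`** (`m ≥ 1`; `n = 10, 42, 170, …`; `3n + 2 = 2^{2m+3}`,
`s_H = 2m + 3`): every `[[n,k,3]]` stabilizer code, degenerate or non-degenerate, has `n − k ≥ s_H + 1 = 2m + 4`.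
[cite: YuEtAl2013, §IV Thm. 3 (chunk p0007 L31-33), case n = 8f_m + 2] -/
theorem YuEtAl2013_theorem3_8f_add_two {m k : ℕ} (hm : 1 ≤ m) (h : AdditiveCodeExists (8 * (4 ^ m - 1) / 3 + 2) k 3) :
    k + (2 * m + 4) ≤ 8 * (4 ^ m - 1) / 3 + 2 := by
  set n := 8 * (4 ^ m - 1) / 3 + 2 with hn
  have hmod := four_pow_mod_three m
  have h4 : 4 ≤ 4 ^ m := by
    calc (4 : ℕ) = 4 ^ 1 := by norm_num
      _ ≤ 4 ^ m := Nat.pow_le_pow_right (by norm_num) hm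
  have h3n : 3 * n + 2 = 8 * 4 ^ m := by omega
  have h2pow : (2 : ℕ) ^ (2 * m + 3) = 8 * 4 ^ m := by
    rw [pow_add, pow_mul]; norm_num; ring
  have hn_ge : 2 * m + 4 ≤ n := by
    have h' : ∀ t : ℕ, 1 ≤ t → 3 * (2 * t + 4) + 2 ≤ 8 * 4 ^ t := fun t ht => by
      induction t with
      | zero => omega
      | succ i ih =>
        rcases Nat.eq_zero_or_pos i with hi | hi
        · subst hi; norm_num
        · have := ih hi; rw [pow_succ]; omega
    have := h' m hm
    omega
  rcases Nat.eq_zero_or_pos k with hk0 | hk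
  · omega
  -- `c = (3n+2)/4 = 2·4^m`
  have hc4 : 4 * (2 * 4 ^ m) = 3 * n + 2 := by omega
  have hlt : 2 ^ (2 * m + 3) < 2 ^ (n - k) := by
    rw [h2pow, ← h3n]
    rcases h.crssLP_three_or_large hk with hlp | hbig
    · have := hlp.lt_of_8f_add_two_length hc4 (by omega)
      exact_mod_cast this
    · omega
  have := (Nat.pow_lt_pow_iff_right (by norm_num : 1 < 2)).1 hlt
  omega

/-! ### 7. Instances (the `l`-labelled lengths `n = 41, 42, 84` of Table I beyond the `n ≤ 30` tables) -/

/-- No `[[41,34,3]]` stabilizer code (`41 = 8f_2 + 1`: `k ≤ 33`, one below the quantum Hamming bound `k ≤ 34`).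
[cite: YuEtAl2013, §IV Thm. 3 with Table I (length 41 labelled l)] -/
theorem no_code_41_34_3 : ¬ AdditiveCodeExists 41 34 3 := fun h => by
  have := YuEtAl2013_theorem3_8f_add_one (m := 2) (by norm_num) (k := 34) (by simpa using h)
  norm_num at this

/-- No `[[42,35,3]]` stabilizer code (`42 = 8f_2 + 2`: `k ≤ 34`, one below the quantum Hamming bound `k ≤ 35`).
[cite: YuEtAl2013, §IV Thm. 3 with Table I (length 42 labelled l)] -/
theorem no_code_42_35_3 : ¬ AdditiveCodeExists 42 35 3 := fun h => by
  have := YuEtAl2013_theorem3_8f_add_two (m := 2) (by norm_num) (k := 35) (by simpa using h)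
  norm_num at this

/-- No `[[84,76,3]]` stabilizer code (`84 = f_4 − 1`: `k ≤ 75`, one below the quantum Hamming bound `k ≤ 76`).
[cite: YuEtAl2013, §IV Thm. 3 with Table I (length 84 labelled l)] -/
theorem no_code_84_76_3 : ¬ AdditiveCodeExists 84 76 3 := fun h => by
  have := YuEtAl2013_theorem3_f (m := 2) (by norm_num) (k := 76) (by simpa using h)
  norm_num at this

end Literature.InformationTheory.QuantumCodes
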